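import Literature.AlgebraicGeometry.GroupSchemes.FrobeniusKernelInclusionAssembly
import Literature.AlgebraicGeometry.AbelianSchemes.SerreTensorIdealTranslationKernelScheme
import HarnessLib

/-!
# `A[F_q] = A[𝔞]` on points — the ideal form: the Frobenius kernel is the torsion of an ideal `𝔞` that absorbs `q` at its places

Topic `Literature/AlgebraicGeometry/GroupSchemes`; namespace `Literature.AlgebraicGeometry.AbelianSchemes.AbelianSchemeOver` (the currency of ★
`RelFrobeniusVersusEndomorphism` ∕ ★ `FrobeniusVersusHeckeSerreTensor`).  THEOREMS ONLY (no definition, no named fact, no instance, no notation, no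
`sorry`).  Cell `hodgecm-mathlib` (D-0151), FLOOR 0, P6 «MOD programme» (crux hLiu418 = stmt-HodgeConjecture-24832, `--supports`, count-neutral):
organ **(O-δ) «MULT-BLOCK ∕ FROB₀-UNIT», part 4 «IDEAL FORM»** (lead hand B-p17; parts 1–2 ★ `KernelRecognitionByRank`,
★ `FrobeniusKernelInclusionAssembly`).  The heart's FROB₀ datum for the CM factor `A₀` is an IDEAL (`twistIdeal γ_σ = 𝔭_w^{d_w}·𝔟`, HEART-FROB v4.1
§0∕§E; desk F0P6a-plan (g1) D-3), not an element `π₀`; σ2-CORE (★ `exists_iso_relFrobeniusHom_comp_eq_comp_serreTranslate`) consumes the kernel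
identity in the shape `t ≫ F = 1 ↔ ∀ c ∈ 𝔠, t ≫ ι(c) ≫ φ = 1`.  This file delivers that shape for `φ = 𝟙` («`A₀[F_q] = A₀[𝔞]`»): with generators
`P₁, …, P_m` of `𝔞` (a column `P`, ★ `idealTuple act P : A → Aᵐ`, whose kernel is `A[𝔞]`), the per-generator decompositions `P_j = P_j·ε + q·c_j`
(★ `CoprimeIdealDecompositionElements`: every element of the multiplicative part `I ⊇ 𝔞` of `(q)` decomposes), ONE étale kernel `Ker ι(a)` with
`a^d·ε = q·c′`, and the degree count `rank A[𝔞] = p^{n·dim A}` (`= N(𝔞)^h = q^{dim A₀}` for the CM factor), one gets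
`t ≫ F = 1 ↔ ∀ c ∈ 𝔞, t ≫ ι(c) = 1` for every `T`-point `t`.  HC_CM is proved only modulo the printed citations until rung 0 closes; this file is
generic and changes no count.

THE MATHEMATICS ([MilneCM2006] §7 (Prop. 7.22, Rem. 7.23): the `𝔞`-torsion `A[𝔞] = ⋂_{a ∈ 𝔞} Ker ι(a) = Ker (ι(P₁), …, ι(P_m))` for generators
`P_j` of `𝔞`; [MumfordAV1970] §15 (p. 146): `deg Fⁿ_{A∕k} = p^{n·dim A}`; [Shimura1998] §13.1 Thm. 1 (pp. 97–99): the Frobenius of a CM abelian variety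
is `ι` of (a generator of) the ideal `N_Φ(𝔓)`, read here as an equality of kernels).  `⊆`: each `ι(P_j)` kills `Ker F` (★ part 2,
`kerι_relFrobeniusHom_comp_i_eq_one_of_decomp` with the étale input `kerι_relFrobeniusHom_comp_i_eq_one_of_etale_ker`), hence so does the tuple map
(★ `comp_idealTuple_eq_one_iff`); `=`: kernel recognition by rank (★ part 1) for `f = F`, `f′ = idealTuple act P`; finally `t ≫ idealTuple act P = 1`
iff `ι(c)` kills `t` for every `c` in the SPAN of the `P_j` (`ι` is additive and multiplicative in `c`, ★ `RingAction.comp_i_add` ∕ `comp_i_mul`).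

* §1 (any base) `forall_mem_span_comp_i_eq_one` (generators kill `t` ⟹ the ideal kills `t`), `comp_idealTuple_eq_one_iff_forall_mem_span`.
* §2 `kerι_relFrobeniusHom_comp_idealTuple_eq_one_of_decomp_of_etale_ker` (`Ker F ⊆ A[𝔞]`),
  **`comp_relFrobeniusHom_eq_one_iff_forall_mem_of_decomp_of_etale_ker`** (`A[F_q] = A[𝔞]` on points).

## References
* [MilneCM2006] J. S. Milne, *Complex Multiplication* (2006), §7, Def. 7.19, Prop. 7.22, Rem. 7.23 (pp. 58–59) (`𝔞`-torsion and `𝔞`-multiplications).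
* [MumfordAV1970] D. Mumford, *Abelian Varieties* (1970), §15 (p. 146) (`F_{A∕k}`, degree `q^{dim A}`), §14.
* [Shimura1998] G. Shimura, *Abelian Varieties with Complex Multiplication and Modular Functions* (1998), §13.1 Thm. 1 (pp. 97–99).
* [Tate1997FiniteFlatGroupSchemes] J. Tate, *Finite flat group schemes* (1997), (3.7).
-/

set_option autoImplicit false

noncomputable section

universe u

open CategoryTheory CategoryTheory.Limits AlgebraicGeometry MonoidalCategory CartesianMonoidalCategory
open scoped MonObj

namespace Literature.AlgebraicGeometry.AbelianSchemes.AbelianSchemeOver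

open Literature.AlgebraicGeometry.Motives Literature.AlgebraicGeometry.Motives.AbelianVariety
open Literature.AlgebraicGeometry.GroupSchemes Literature.AlgebraicGeometry.GroupSchemes.GroupSchemeKernel

section SpanClosure

variable {S : Scheme.{u}} {A : AbelianSchemeOver S} {O : Type*} [CommRing O] (act : A.RingAction O)

/-- **Generators kill `t` ⟹ the ideal kills `t`**: if `t ≫ ι(P_j) = 1` for every `j`, then `t ≫ ι(c) = 1` for every `c` in the ideal spanned
by the `P_j` (`ι(x + y) = ι(x)·ι(y)`, `ι(r·x) = ι(x) ≫ ι(r)` on points, ★ `RingAction.comp_i_add` ∕ `comp_i_mul`).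
[cite: MilneCM2006, §7 (Def. 7.19, Prop. 7.22, Rem. 7.23, pp. 58–59)] -/
theorem forall_mem_span_comp_i_eq_one {m : ℕ} (P : Matrix (Fin m) (Fin 1) O) {T : Over S} (t : T ⟶ A.X)
    (ht : ∀ k, t ≫ act.i (P k 0) = 1) :
    ∀ c ∈ Ideal.span (Set.range fun k => P k 0), t ≫ act.i c = 1 := by
  intro c hc
  induction hc using Submodule.span_induction with
  | mem x hx =>
      obtain ⟨k, rfl⟩ := hx
      exact ht k
  | zero => exact (act.comp_i_zero_one t).1
  | add x y _ _ hx hy => rw [act.comp_i_add, hx, hy, one_mul]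
  | smul r x _ hx =>
      haveI := act.isMonHom r
      rw [smul_eq_mul, act.comp_i_mul, hx, MonObj.one_comp]

/-- **`Ker (ι(P₁), …, ι(P_m)) = A[𝔞]` on points, `𝔞 = (P₁, …, P_m)`**: `t ≫ idealTuple act P = 1 ↔ ∀ c ∈ span {P_j}, t ≫ ι(c) = 1` (★
`comp_idealTuple_eq_one_iff` + §1). [cite: MilneCM2006, §7 (Def. 7.19, Prop. 7.22, Rem. 7.23, pp. 58–59)] -/
theorem comp_idealTuple_eq_one_iff_forall_mem_span {m : ℕ} (P : Matrix (Fin m) (Fin 1) O) {T : Over S} (t : T ⟶ A.X) :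
    t ≫ idealTuple act P = 1 ↔ ∀ c ∈ Ideal.span (Set.range fun k => P k 0), t ≫ act.i c = 1 := by
  rw [comp_idealTuple_eq_one_iff]
  exact ⟨fun h => forall_mem_span_comp_i_eq_one act P t h, fun h k => h _ (Ideal.subset_span ⟨k, rfl⟩)⟩

end SpanClosure

section IdealForm

variable {k : Type u} [Field k] [PerfectField k] (p : ℕ) [Fact p.Prime] [CharP k p] (n : ℕ) {A : AbelianVariety k}
  {O : Type*} [CommRing O] (act : (AbelianScheme.ofAbelianVariety A).toOver.RingAction O)

/-- **`Ker Fⁿ_{A∕k} ⊆ A[𝔞]`** (`𝔞 = (P₁, …, P_m)`): if every generator decomposes as `P_j = P_j·ε + q·c_j`, `Ker ι(a)` is étale and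
`a^d·ε = q·c′`, then the tuple map `(ι(P_j))_j` kills `Ker F` (★ part 2 per generator, ★ `comp_idealTuple_eq_one_iff`).
[cite: MumfordAV1970, §14 and §15 (p. 146)] [cite: Tate1997FiniteFlatGroupSchemes, (3.7)] -/
theorem kerι_relFrobeniusHom_comp_idealTuple_eq_one_of_decomp_of_etale_ker {m : ℕ} (P : Matrix (Fin m) (Fin 1) O) (ε a c' : O) (d : ℕ)
    (hdec : ∀ j, ∃ c : O, P j 0 = P j 0 * ε + ((p ^ n : ℕ) : O) * c) (het : Etale (ker (act.i a)).hom)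
    (h : a ^ d * ε = ((p ^ n : ℕ) : O) * c') :
    kerι (relFrobeniusHom p n A) ≫ idealTuple act P = 1 := by
  have hε := kerι_relFrobeniusHom_comp_i_eq_one_of_etale_ker p n act a ε c' d het h
  rw [comp_idealTuple_eq_one_iff]
  intro j
  obtain ⟨c, hc⟩ := hdec j
  exact kerι_relFrobeniusHom_comp_i_eq_one_of_decomp p n act _ ε c hc hε

/-- **`A[F_q] = A[𝔞]` ON POINTS — IDEAL FORM OF FROB₀.**  `k` perfect of characteristic `p`, `q = pⁿ`, `A∕k` an abelian variety with an
`𝒪`-action `ι`, `𝔞 = (P₁, …, P_m)` an ideal of `𝒪` with: (D) `P_j = P_j·ε + q·c_j` for every generator, (D′) `a^d·ε = q·c′`, (E) `Ker ι(a) → Spec k`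
étale, and the DEGREE COUNT `rank A[𝔞] = rank Ker (ι(P_j))_j = p^{n·dim A}`.  Then for every `T`-point `t` of `A`:
`t ≫ Fⁿ_{A∕k} = 1 ↔ ∀ c ∈ 𝔞, t ≫ ι(c) = 1` — the `hker` of ★ `FrobeniusVersusHeckeSerreTensor.exists_iso_relFrobeniusHom_comp_eq_comp_serreTranslate`
at `φ = 𝟙` (σ2-CORE for the CM factor `A₀`, whose Frobenius IDEAL `𝔞 = 𝔭_w^{d_w}·𝔟` is the desk's `twistIdeal`; [Shimura1998] §13.1 Thm. 1).
[cite: Shimura1998, §13.1 Thm. 1 (pp. 97–99)] [cite: MumfordAV1970, §15 (p. 146)] [cite: MilneCM2006, §7 (Def. 7.19, Prop. 7.22, Rem. 7.23, pp. 58–59)]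
[cite: Tate1997FiniteFlatGroupSchemes, (3.7)] -/
theorem comp_relFrobeniusHom_eq_one_iff_forall_mem_of_decomp_of_etale_ker {m : ℕ} (P : Matrix (Fin m) (Fin 1) O) {𝔞 : Ideal O}
    (h𝔞 : Ideal.span (Set.range fun j => P j 0) = 𝔞) (ε a c' : O) (d : ℕ)
    (hdec : ∀ j, ∃ c : O, P j 0 = P j 0 * ε + ((p ^ n : ℕ) : O) * c) (het : Etale (ker (act.i a)).hom)
    (h : a ^ d * ε = ((p ^ n : ℕ) : O) * c')
    [IsFinite (ker (idealTuple act P)).hom] [Flat (ker (idealTuple act P)).hom]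
    (hdeg : ∀ s, (ker (idealTuple act P)).hom.finrank s = p ^ (n * A.dim))
    {T : Over (Spec (.of k))} (t : T ⟶ (AbelianScheme.ofAbelianVariety A).toOver.X) :
    t ≫ relFrobeniusHom p n A = 1 ↔ ∀ c ∈ 𝔞, t ≫ act.i c = 1 := by
  have hle := kerι_relFrobeniusHom_comp_idealTuple_eq_one_of_decomp_of_etale_ker p n act P ε a c' d hdec het h
  haveI : IsSeparated (AbelianScheme.ofAbelianVariety (A.frobeniusTwist p n)).toOver.X.hom :=
    inferInstanceAs (IsSeparated (A.frobeniusTwist p n).X.hom)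
  haveI := ((AbelianScheme.ofAbelianVariety A).toOver.pow m).isProper
  haveI : Flat (ker (relFrobeniusHom p n A)).hom := flat_ker_relFrobenius_hom p n A
  have key : t ≫ relFrobeniusHom p n A = 1 ↔ t ≫ idealTuple act P = 1 := by
    refine comp_eq_one_iff_of_kerι_comp_eq_one_of_finrank_eq (relFrobeniusHom p n A) (idealTuple act P) hle (fun s => ?_) t
    have h1 : (ker (relFrobeniusHom p n A)).hom.finrank s = p ^ (n * A.dim) := finrank_ker_relFrobenius_hom p n A s
    rw [h1, hdeg]
  rw [key, comp_idealTuple_eq_one_iff_forall_mem_span, h𝔞]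

end IdealForm

end Literature.AlgebraicGeometry.AbelianSchemes.AbelianSchemeOver

end
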